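import Summits.Ventures.CertifiedManyBodySolver.Downfold.EmeryOrbitalWeightFaceDirBox
import Summits.Ventures.CertifiedManyBodySolver.Downfold.EmeryVanHoveSubBox
import Summits.Ventures.CertifiedManyBodySolver.Downfold.EmeryVanHoveTableB
import Summits.Ventures.CertifiedManyBodySolver.Downfold.EmeryVanHoveTableF
import Summits.Ventures.CertifiedManyBodySolver.Downfold.EmeryFermiFaceDirPointsHg1212K26NH120S1
import Summits.Ventures.CertifiedManyBodySolver.Downfold.EmeryFermiFaceDirPointsHg1212K26NH120S2
import HarnessLib

/-!
# THE ANTINODAL FERMI-SURFACE Cu-d WEIGHT OVER THE TYPED 3BE BOX `emeryBoxHg1212K26Src (EmeryBoxesKSlicesG)` AT FILLING n_H = 1.20 (ν = 2/5), regime-free rule v2 — the kinematic leg of the UPPER member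
# `U_B∣full(w_antinode)` of the weak band-level `U` bracket read over a box where the v1 rule's antinodal charge-transfer regime FAILS at the low-Δ corners
# (INFL-3to1-B §B.90 (j); kernel `EmeryOrbitalWeightFaceDirBox`; router/EMERY-FS-WEIGHT-BRACKETS.tsv / OBJECT-E-BUDGET.tsv §C)

Venture CertifiedManyBodySolver, cell `pub/hubbard-downfold` (stage S1), seat hubbard-downfold-mod-4 (technique B, g39); namespace
`Summit.Ventures.CertifiedManyBodySolver.Downfold.Emery`. Everything PROVED (0 sorry). WHAT THIS IS NOT: a statement about the material — the typed box (HgBa₂CaCu₂O₆₊δ plane ((K) source box))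
is SCREENING-GRADE; `U = 0` one-body kinematics of the σ model; the `U_B` arithmetic that consumes the window is DERIVED context on the MEAN-FIELD annex (R-B17).

For every member θ = (Δ, t_pd, t_pp, t_pp′) ∈ [1.85, 2.45] × [1.205, 1.28] × [0.644, 0.663] × [0.163, 0.187] eV at filling ν = 2/5, the Cu-d weight of the ANTINODAL Bloch state,
`dWeightFace θ (fermiEnergyOf θ ν)`, lies in the window below. DEVICE (v2): `W(θ) = W(Δ/t_pd, 1, t_pp/t_pd, t_pp′/t_pd)` (scaling law); the t_pd range is cut into 2 slabs; on each
normalised slab the v2 CORNER RULE `dWeightFace_fermiEnergyOf_mem_Icc_of_mem_box3_dir_num`: Δ ↑ at fixed filling WITHOUT the regime (region-wide directional certificate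
`faceDir_nonneg_of_mem_region`, κ₀ = 1/10, + the Fermi-energy slope law κ = 1/10 + mean value theorem), t_pp ↓, t_pp′ ↑ only at the upper corner (regime margin R2 there),
lower end `t_pp′`-decoupled (`dWeightFaceLoDec` at `E_h`); hole-likeness from the slab's `vhBoxCheck` + the Ψ table; two K = 384 Fermi-energy brackets per slab
(`EmeryFermiFaceDirPointsHg1212K26NH120S<k>`). The slab corners are VIRTUAL (not members): the window is a sound ENCLOSURE (lower end ≈ 0.02 below the v1 virtual-corner value).

| t_pd slab (eV) | normalised slab Δ/t_pd × t_pp/t_pd × t_pp′/t_pd | q₁ (vhBoxCheck) ≥ table point | E_h | E_v | margins (R2, 1 − κ − w̄_axis) | **w_face window** |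
|---|---|---|---|---|---|---|
| [1.205, 1.242] | [1.489, 2.033] × [0.5183, 0.5502] × [0.1312, 0.1552] | 0.5876 ≥ 117/200 (Ψ ≤ 0.3828) | 1.2837 | 1.0939 | +0.433, +0.124 | **[0.6993, 0.7702]** |
| [1.242, 1.28] | [1.445, 1.972] × [0.5031, 0.5336] × [0.1273, 0.1505] | 0.5758 ≥ 14/25 (Ψ ≤ 0.3858) | 1.2967 | 1.1107 | +0.468, +0.130 | **[0.6952, 0.7648]** |
| **whole box** | (hull of the slabs) | | | | | **[0.6952, 0.7702]** |

Sources: three-band model [HybertsenSchluterChristensen1989, Eq. (1)]; face point of the bilinear contour [AndersenEtAl1995, §6]; [folklore] algebra.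
-/

noncomputable section

namespace Summit.Ventures.CertifiedManyBodySolver.Downfold.Emery

open Real Set

/-- **Slab 1 (t_pd ∈ [1.205, 1.242] eV) of `emeryBoxHg1212K26Src (EmeryBoxesKSlicesG)`, ν = 2/5: the antinodal Fermi-surface Cu-d weight of every member lies in `[0.6993, 0.7702]`**
(normalised-slab v2 corner rule; brackets `faceDirPt_Hg1212K26_nH120_s1_lo_br` / `_hi_br`). [folklore] -/
theorem hg1212K26Box_dWeightFaceDir_nH120_s1 {Δ a b c : ℝ} (hΔ : Δ ∈ Icc ((37 : ℝ) / 20) ((49 : ℝ) / 20)) (ha : a ∈ Icc ((241 : ℝ) / 200) ((497 : ℝ) / 400)) (hb : b ∈ Icc ((161 : ℝ) / 250) ((663 : ℝ) / 1000)) (hc : c ∈ Icc ((163 : ℝ) / 1000) ((187 : ℝ) / 1000)) :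
    dWeightFace Δ a b c (fermiEnergyOf Δ a b c ((2 : ℝ) / 5)) ∈ Icc ((6993 : ℝ) / 10000) ((3851 : ℝ) / 5000) := by
  have ha0 : 0 < a := lt_of_lt_of_le (by norm_num) ha.1
  rw [dWeightFace_fermiEnergyOf_eq_ratios ha0]
  have hΔn : Δ / a ∈ Icc ((740 : ℝ) / 497) ((490 : ℝ) / 241) := by
    constructor
    · rw [le_div_iff₀ ha0]; linarith [hΔ.1, ha.2]
    · rw [div_le_iff₀ ha0]; linarith [hΔ.2, ha.1]
  have hbn : b / a ∈ Icc ((184 : ℝ) / 355) ((663 : ℝ) / 1205) := by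
    constructor
    · rw [le_div_iff₀ ha0]; linarith [hb.1, ha.2]
    · rw [div_le_iff₀ ha0]; linarith [hb.2, ha.1]
  have hcn : c / a ∈ Icc ((326 : ℝ) / 2485) ((187 : ℝ) / 1205) := by
    constructor
    · rw [le_div_iff₀ ha0]; linarith [hc.1, ha.2]
    · rw [div_le_iff₀ ha0]; linarith [hc.2, ha.1]
  have hVH : ∀ Δ' b' c' : ℝ, Δ' ∈ Icc ((740 : ℝ) / 497) ((490 : ℝ) / 241) → b' ∈ Icc ((184 : ℝ) / 355) ((663 : ℝ) / 1205) → c' ∈ Icc ((326 : ℝ) / 2485) ((187 : ℝ) / 1205) →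
      1 - 2 * ((2 : ℝ) / 5) ≤ xVH Δ' 1 b' c' := by
    intro Δ' b' c' hΔ' hb' hc'
    have h := xVH_window_of_vhBoxCheck (Δ₁ := ((740 : ℚ) / 497)) (Δ₂ := ((490 : ℚ) / 241)) (a₁ := (1 : ℚ)) (a₂ := (1 : ℚ)) (b₁ := ((184 : ℚ) / 355)) (b₂ := ((663 : ℚ) / 1205))
      (c₁ := ((326 : ℚ) / 2485)) (c₂ := ((187 : ℚ) / 1205)) (v₁ := ((2683 : ℚ) / 2500)) (v₂ := ((12323 : ℚ) / 10000)) (e := ((6031 : ℚ) / 5000)) (E := ((10951 : ℚ) / 10000))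
      (q₁ := ((1469 : ℚ) / 2500)) (q₂ := ((319 : ℚ) / 400)) (by decide +kernel)
      (Δ := Δ') (tpd := 1) (tpp := b') (c := c') (by simpa using hΔ') (by simp) (by simpa using hb') (by simpa using hc')
    obtain ⟨-, -, -, -, -, hwin⟩ := h
    push_cast at hwin
    have ht := vhFrac_117_200
    have hmono := vhFrac_anti (show (117 / 200 : ℝ) ≤ ((1469 : ℝ) / 2500) by norm_num)
    have hnu : ((56450 : ℝ) / 147456) ≤ ((2 : ℝ) / 5) := by norm_num
    linarith [hwin.1, ht.2]
  have hEh := (fermiEnergyOf_of_pointBracketCheck faceDirPt_Hg1212K26_nH120_s1_lo_br (by norm_num) (by norm_num) (by norm_num) (ν := (2/5 : ℝ))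
    (by push_cast; exact ⟨le_rfl, le_rfl⟩)).2
  have hEv := (fermiEnergyOf_of_pointBracketCheck faceDirPt_Hg1212K26_nH120_s1_hi_br (by norm_num) (by norm_num) (by norm_num) (ν := (2/5 : ℝ))
    (by push_cast; exact ⟨le_rfl, le_rfl⟩)).2
  push_cast at hEh hEv
  refine dWeightFace_fermiEnergyOf_mem_Icc_of_mem_box3_dir_num (Eh := ((12837 : ℝ) / 10000)) (Ev := ((10939 : ℝ) / 10000)) (Elow := ((10839 : ℝ) / 10000)) (κ₀ := 1 / 10) (κ := 1 / 10)
    (by norm_num) one_pos (by norm_num) (by norm_num) (by norm_num) hΔn hbn hcn (by norm_num) (by norm_num) hVH hEh.2 (by norm_num)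
    (by norm_num [faceU, fsD, fsN, cA]) (by norm_num [faceU, fsD, fsN, cA]) (by norm_num [faceU, fsD, fsN, cA]) (by norm_num [faceU, fsD, fsN, cA])
    hEv.1 (by norm_num) (by norm_num) (by norm_num [faceG]) (by norm_num) (by norm_num) (by norm_num) le_rfl (by norm_num [dWeightAxisCF])
    (by norm_num) (by norm_num) ?_ (by norm_num [dWeightFaceLoDec, faceRUp, faceN]) (by norm_num [dWeightFaceCF, faceN, faceR, fsN])
  intro D B C e hD hB hC he hG
  exact faceDir_nonneg_of_mem_region ⟨le_trans (by norm_num) hD.1, le_trans hD.2 (by norm_num)⟩ ⟨le_trans (by norm_num) he.1, le_trans he.2 (by norm_num)⟩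
    ⟨le_trans (by norm_num) hB.1, le_trans hB.2 (by norm_num)⟩ ⟨le_trans (by norm_num) hC.1, le_trans hC.2 (by norm_num)⟩ hG

/-- **Slab 2 (t_pd ∈ [1.242, 1.28] eV) of `emeryBoxHg1212K26Src (EmeryBoxesKSlicesG)`, ν = 2/5: the antinodal Fermi-surface Cu-d weight of every member lies in `[0.6952, 0.7648]`**
(normalised-slab v2 corner rule; brackets `faceDirPt_Hg1212K26_nH120_s2_lo_br` / `_hi_br`). [folklore] -/
theorem hg1212K26Box_dWeightFaceDir_nH120_s2 {Δ a b c : ℝ} (hΔ : Δ ∈ Icc ((37 : ℝ) / 20) ((49 : ℝ) / 20)) (ha : a ∈ Icc ((497 : ℝ) / 400) ((32 : ℝ) / 25)) (hb : b ∈ Icc ((161 : ℝ) / 250) ((663 : ℝ) / 1000)) (hc : c ∈ Icc ((163 : ℝ) / 1000) ((187 : ℝ) / 1000)) :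
    dWeightFace Δ a b c (fermiEnergyOf Δ a b c ((2 : ℝ) / 5)) ∈ Icc ((869 : ℝ) / 1250) ((478 : ℝ) / 625) := by
  have ha0 : 0 < a := lt_of_lt_of_le (by norm_num) ha.1
  rw [dWeightFace_fermiEnergyOf_eq_ratios ha0]
  have hΔn : Δ / a ∈ Icc ((185 : ℝ) / 128) ((140 : ℝ) / 71) := by
    constructor
    · rw [le_div_iff₀ ha0]; linarith [hΔ.1, ha.2]
    · rw [div_le_iff₀ ha0]; linarith [hΔ.2, ha.1]
  have hbn : b / a ∈ Icc ((161 : ℝ) / 320) ((1326 : ℝ) / 2485) := by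
    constructor
    · rw [le_div_iff₀ ha0]; linarith [hb.1, ha.2]
    · rw [div_le_iff₀ ha0]; linarith [hb.2, ha.1]
  have hcn : c / a ∈ Icc ((163 : ℝ) / 1280) ((374 : ℝ) / 2485) := by
    constructor
    · rw [le_div_iff₀ ha0]; linarith [hc.1, ha.2]
    · rw [div_le_iff₀ ha0]; linarith [hc.2, ha.1]
  have hVH : ∀ Δ' b' c' : ℝ, Δ' ∈ Icc ((185 : ℝ) / 128) ((140 : ℝ) / 71) → b' ∈ Icc ((161 : ℝ) / 320) ((1326 : ℝ) / 2485) → c' ∈ Icc ((163 : ℝ) / 1280) ((374 : ℝ) / 2485) →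
      1 - 2 * ((2 : ℝ) / 5) ≤ xVH Δ' 1 b' c' := by
    intro Δ' b' c' hΔ' hb' hc'
    have h := xVH_window_of_vhBoxCheck (Δ₁ := ((185 : ℚ) / 128)) (Δ₂ := ((140 : ℚ) / 71)) (a₁ := (1 : ℚ)) (a₂ := (1 : ℚ)) (b₁ := ((161 : ℚ) / 320)) (b₂ := ((1326 : ℚ) / 2485))
      (c₁ := ((163 : ℚ) / 1280)) (c₂ := ((374 : ℚ) / 2485)) (v₁ := ((10913 : ℚ) / 10000)) (v₂ := ((12487 : ℚ) / 10000)) (e := ((1223 : ℚ) / 1000)) (E := ((1113 : ℚ) / 1000))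
      (q₁ := ((2879 : ℚ) / 5000)) (q₂ := ((7757 : ℚ) / 10000)) (by decide +kernel)
      (Δ := Δ') (tpd := 1) (tpp := b') (c := c') (by simpa using hΔ') (by simp) (by simpa using hb') (by simpa using hc')
    obtain ⟨-, -, -, -, -, hwin⟩ := h
    push_cast at hwin
    have ht := vhFrac_14_25
    have hmono := vhFrac_anti (show (14 / 25 : ℝ) ≤ ((2879 : ℝ) / 5000) by norm_num)
    have hnu : ((56885 : ℝ) / 147456) ≤ ((2 : ℝ) / 5) := by norm_num
    linarith [hwin.1, ht.2]
  have hEh := (fermiEnergyOf_of_pointBracketCheck faceDirPt_Hg1212K26_nH120_s2_lo_br (by norm_num) (by norm_num) (by norm_num) (ν := (2/5 : ℝ))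
    (by push_cast; exact ⟨le_rfl, le_rfl⟩)).2
  have hEv := (fermiEnergyOf_of_pointBracketCheck faceDirPt_Hg1212K26_nH120_s2_hi_br (by norm_num) (by norm_num) (by norm_num) (ν := (2/5 : ℝ))
    (by push_cast; exact ⟨le_rfl, le_rfl⟩)).2
  push_cast at hEh hEv
  refine dWeightFace_fermiEnergyOf_mem_Icc_of_mem_box3_dir_num (Eh := ((12967 : ℝ) / 10000)) (Ev := ((11107 : ℝ) / 10000)) (Elow := ((11007 : ℝ) / 10000)) (κ₀ := 1 / 10) (κ := 1 / 10)
    (by norm_num) one_pos (by norm_num) (by norm_num) (by norm_num) hΔn hbn hcn (by norm_num) (by norm_num) hVH hEh.2 (by norm_num)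
    (by norm_num [faceU, fsD, fsN, cA]) (by norm_num [faceU, fsD, fsN, cA]) (by norm_num [faceU, fsD, fsN, cA]) (by norm_num [faceU, fsD, fsN, cA])
    hEv.1 (by norm_num) (by norm_num) (by norm_num [faceG]) (by norm_num) (by norm_num) (by norm_num) le_rfl (by norm_num [dWeightAxisCF])
    (by norm_num) (by norm_num) ?_ (by norm_num [dWeightFaceLoDec, faceRUp, faceN]) (by norm_num [dWeightFaceCF, faceN, faceR, fsN])
  intro D B C e hD hB hC he hG
  exact faceDir_nonneg_of_mem_region ⟨le_trans (by norm_num) hD.1, le_trans hD.2 (by norm_num)⟩ ⟨le_trans (by norm_num) he.1, le_trans he.2 (by norm_num)⟩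
    ⟨le_trans (by norm_num) hB.1, le_trans hB.2 (by norm_num)⟩ ⟨le_trans (by norm_num) hC.1, le_trans hC.2 (by norm_num)⟩ hG

/-- **`emeryBoxHg1212K26Src (EmeryBoxesKSlicesG)`, ν = 2/5: for EVERY member θ the Cu-d weight of the antinodal Fermi-surface state lies in `[0.6952, 0.7702]`** (hull of the 2 t_pd slab windows; regime-free rule v2). [folklore] -/
theorem hg1212K26Box_dWeightFaceDir_nH120 {Δ a b c : ℝ} (hΔ : Δ ∈ Icc ((37 : ℝ) / 20) ((49 : ℝ) / 20)) (ha : a ∈ Icc ((241 : ℝ) / 200) ((32 : ℝ) / 25)) (hb : b ∈ Icc ((161 : ℝ) / 250) ((663 : ℝ) / 1000)) (hc : c ∈ Icc ((163 : ℝ) / 1000) ((187 : ℝ) / 1000)) :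
    dWeightFace Δ a b c (fermiEnergyOf Δ a b c ((2 : ℝ) / 5)) ∈ Icc ((869 : ℝ) / 1250) ((3851 : ℝ) / 5000) := by
  rcases le_or_gt a ((497 : ℝ) / 400) with h1 | h1
  · have h := hg1212K26Box_dWeightFaceDir_nH120_s1 hΔ ⟨ha.1, h1⟩ hb hc
    exact ⟨le_trans (by norm_num) h.1, le_trans h.2 (by norm_num)⟩
  · have h := hg1212K26Box_dWeightFaceDir_nH120_s2 hΔ ⟨h1.le, ha.2⟩ hb hc
    exact ⟨le_trans (by norm_num) h.1, le_trans h.2 (by norm_num)⟩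

end Summit.Ventures.CertifiedManyBodySolver.Downfold.Emery
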